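import Summits.FinalStateConjecture.FinalStateConjecture.Theorems.ClusterCompletenessAdiabaticMultiKerrILEDLateCollar
import Summits.FinalStateConjecture.FinalStateConjecture.Theorems.ClusterCompletenessAdiabaticMultiKerrILEDLateTransport
import HarnessLib

/-!
# Route ClusterCompleteness — crux `AdiabaticMultiKerrILED`, line `Sketch`: splitting the lab
# energy into the far part and the collars (helper for `stub_lateAssembly`)

Helper file for the crux `stmt-FinalStateConjecture-14310`
(`Summit.FinalStateConjecture.FinalStateConjecture.Theses.ClusterCompleteness.AdiabaticMultiKerrILED`),
line `Sketch`, serving the lead's assembly stub `stub_lateAssembly`.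

`late_energy_split`: on a lab slice `{x⁰ = τ}`, `τ ≥ 0`, of the strictly receding configuration,
the exterior lab energy `∫_{∀i, r₊ᵢ < rᵢ} Σ(∂ψ)²` is at most the far energy
`∫_{∀i, r₊ᵢ + (η/2)Mᵢ ≤ rᵢ} Σ(∂ψ)²` plus `κ` times the total half-collar quantity
`G(τ) = Σᵢ ∫ (1_{(r₊ᵢ, r₊ᵢ + ηMᵢ/2]} Σ(∂Φᵢ)²)(qᵢ(τ, y)) dy` of the rest-frame pull-backs `Φᵢ`
(gradient comparability `Σ(∂ψ)²(x) ≤ κᵢ Σ(∂Φᵢ)²(qᵢ x)`), and conversely `G(τ) ≤ κ ∫_{ext} Σ(∂ψ)²`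
(collars are exterior, `Σ(∂Φᵢ)²(qᵢ x) ≤ κᵢ Σ(∂ψ)²(x)`); `late_final_bound` is the closing
arithmetic of the boundedness argument. Dafermos–Rodnianski arXiv:0811.0354, §3.3.4. [folklore]
-/

noncomputable section

-- the doubled `FinalStateConjecture.FinalStateConjecture` path component trips dupNamespace
set_option linter.dupNamespace false

open scoped ENNReal BigOperators InnerProductSpace ContDiff
open Set MeasureTheory Literature.Geometry.Lorentzian

namespace Summit.FinalStateConjecture.FinalStateConjecture.Cruxes.AdiabaticMultiKerrILED.Sketch

/-- **Splitting the lab energy into the far part and the collars, and bounding the collars by the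
lab energy** (see the module docstring). [folklore] -/
theorem late_energy_split {N : ℕ} {M a : Fin N → ℝ} {Λ : Fin N → lorentzGroup}
    {p : Fin N → E3} {u : Fin N → E4} {q : Fin N → E4 → E4}
    (hu : ∀ i, u i = (Λ i : E4 ≃L[ℝ] E4) (E4.basisVector 0))
    (hq : ∀ i x, q i x = poincareInv (Λ i) (E4.ofTimeSpace 0 (p i)) x)
    (hM : ∀ i, 0 < M i) (ha : ∀ i, |a i| ≤ 2⁻¹ * M i)
    (hv : ∀ i, 0 < u i 0 ∧ ‖E4.spatial (u i)‖ ≤ 2⁻¹ * u i 0)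
    (hsep : ∀ i j, i ≠ j → 40 * (M i + M j) ≤ dist (p i) (p j) ∧
      0 < ⟪p i - p j, (u i 0)⁻¹ • E4.spatial (u i) - (u j 0)⁻¹ • E4.spatial (u j)⟫_ℝ)
    {η : ℝ} (hη1 : η ≤ 1) {κ : Fin N → ℝ} {κs : ℝ} (hκ0 : ∀ i, 0 ≤ κ i) (hκs : ∀ i, κ i ≤ κs)
    (hκsum : ∑ i, κ i ≤ κs)
    {ψ : E4 → ℝ} (hψ : ContDiff ℝ 1 ψ) {Φ : Fin N → E4 → ℝ}
    (hcmp : ∀ i x, ENNReal.ofReal (∑ μ, fderiv ℝ (Φ i) (q i x) (E4.basisVector μ) ^ 2) ≤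
      ENNReal.ofReal (κ i) * ENNReal.ofReal (∑ μ : Fin 4, (fderiv ℝ ψ x (E4.basisVector μ)) ^ 2))
    (hcmp' : ∀ i x, ENNReal.ofReal (∑ μ : Fin 4, (fderiv ℝ ψ x (E4.basisVector μ)) ^ 2) ≤
      ENNReal.ofReal (κ i) * ENNReal.ofReal (∑ μ, fderiv ℝ (Φ i) (q i x) (E4.basisVector μ) ^ 2))
    {τ : ℝ} (hτ : 0 ≤ τ) :
    (∫⁻ y in {y : E3 | ∀ i, Kerr.rPlus (M i) (a i) < Kerr.radius (a i) (q i (E4.ofTimeSpace τ y))},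
        ENNReal.ofReal (∑ μ : Fin 4, (fderiv ℝ ψ (E4.ofTimeSpace τ y) (E4.basisVector μ)) ^ 2) ≤
      (∫⁻ y in {y : E3 | ∀ i, Kerr.rPlus (M i) (a i) + η / 2 * M i ≤
          Kerr.radius (a i) (q i (E4.ofTimeSpace τ y))},
        ENNReal.ofReal (∑ μ : Fin 4, (fderiv ℝ ψ (E4.ofTimeSpace τ y) (E4.basisVector μ)) ^ 2)) +
        ENNReal.ofReal κs * ∑ i, ∫⁻ y : E3,
          {z : E4 | Kerr.rPlus (M i) (a i) < Kerr.radius (a i) z ∧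
              Kerr.radius (a i) z ≤ Kerr.rPlus (M i) (a i) + η * M i / 2}.indicator
            (fun z ↦ ENNReal.ofReal (∑ μ, fderiv ℝ (Φ i) z (E4.basisVector μ) ^ 2))
            (q i (E4.ofTimeSpace τ y))) ∧
    (∑ i, ∫⁻ y : E3,
          {z : E4 | Kerr.rPlus (M i) (a i) < Kerr.radius (a i) z ∧
              Kerr.radius (a i) z ≤ Kerr.rPlus (M i) (a i) + η * M i / 2}.indicator
            (fun z ↦ ENNReal.ofReal (∑ μ, fderiv ℝ (Φ i) z (E4.basisVector μ) ^ 2))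
            (q i (E4.ofTimeSpace τ y))) ≤
      ENNReal.ofReal κs *
        ∫⁻ y in {y : E3 | ∀ i, Kerr.rPlus (M i) (a i) < Kerr.radius (a i) (q i (E4.ofTimeSpace τ y))},
          ENNReal.ofReal (∑ μ : Fin 4, (fderiv ℝ ψ (E4.ofTimeSpace τ y) (E4.basisVector μ)) ^ 2) := by
  -- ### notation
  set e : Fin N → E4 → ℝ≥0∞ := fun i z ↦
    ENNReal.ofReal (∑ μ, fderiv ℝ (Φ i) z (E4.basisVector μ) ^ 2) with he
  set eψ : E4 → ℝ≥0∞ := fun x ↦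
    ENNReal.ofReal (∑ μ : Fin 4, (fderiv ℝ ψ x (E4.basisVector μ)) ^ 2) with heψ
  set T1 : Fin N → Set E4 := fun i ↦ {z : E4 | Kerr.rPlus (M i) (a i) < Kerr.radius (a i) z ∧
    Kerr.radius (a i) z ≤ Kerr.rPlus (M i) (a i) + η * M i / 2} with hT1
  set Ext : Set E3 := {y : E3 | ∀ i, Kerr.rPlus (M i) (a i) <
    Kerr.radius (a i) (q i (E4.ofTimeSpace τ y))} with hExt
  set Far : Set E3 := {y : E3 | ∀ i, Kerr.rPlus (M i) (a i) + η / 2 * M i ≤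
    Kerr.radius (a i) (q i (E4.ofTimeSpace τ y))} with hFar
  set Col : Fin N → Set E3 := fun i ↦ {y : E3 | Kerr.rPlus (M i) (a i) <
    Kerr.radius (a i) (q i (E4.ofTimeSpace τ y)) ∧
      Kerr.radius (a i) (q i (E4.ofTimeSpace τ y)) ≤ Kerr.rPlus (M i) (a i) + η * M i / 2}
    with hCol
  show (∫⁻ y in Ext, eψ (E4.ofTimeSpace τ y)) ≤ (∫⁻ y in Far, eψ (E4.ofTimeSpace τ y)) +
      ENNReal.ofReal κs * ∑ i, ∫⁻ y : E3, (T1 i).indicator (e i) (q i (E4.ofTimeSpace τ y)) ∧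
    (∑ i, ∫⁻ y : E3, (T1 i).indicator (e i) (q i (E4.ofTimeSpace τ y))) ≤
      ENNReal.ofReal κs * ∫⁻ y in Ext, eψ (E4.ofTimeSpace τ y)
  -- ### measurability
  have hqc : ∀ i, Continuous (q i) := fun i ↦ by
    rw [show q i = poincareInv (Λ i) (E4.ofTimeSpace 0 (p i)) from funext (hq i)]
    exact continuous_poincareInv _ _
  have hsets := measurableSet_slice_sets (fun i x ↦ Kerr.radius (a i) (q i x))
    (fun i ↦ (Kerr.continuous_radius (a i)).comp (hqc i)) (fun i ↦ Kerr.rPlus (M i) (a i))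
    (fun i ↦ Kerr.rPlus (M i) (a i) + η * M i / 2) τ
  have hExtm : MeasurableSet Ext := hsets.1
  have hColm : ∀ i, MeasurableSet (Col i) := hsets.2.2
  have heψm : Measurable fun y : E3 ↦ eψ (E4.ofTimeSpace τ y) :=
    (measurable_energyDensity hψ).comp (E4.continuous_ofTimeSpace τ).measurable
  have hη2 : η / 2 ≤ 1 := by linarith
  -- ### each half collar is exterior and carries at most `κᵢ` times the lab energy
  have hG : ∀ i, ∫⁻ y : E3, (T1 i).indicator (e i) (q i (E4.ofTimeSpace τ y)) ≤
      ENNReal.ofReal (κ i) * ∫⁻ y in Ext, eψ (E4.ofTimeSpace τ y) := by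
    intro i
    refine lintegral_indicator_comp_le_setLIntegral hExtm heψm fun y hy ↦ ⟨?_, hcmp i _⟩
    refine collar_subset_exterior hu hq hM ha hv hsep hη2 hτ i ⟨hy.1, ?_⟩
    have h2 := hy.2
    have : η / 2 * M i = η * M i / 2 := by ring
    linarith
  -- ### each lab collar is carried by the rest-frame half collar
  have hC : ∀ i, ∫⁻ y in Col i, eψ (E4.ofTimeSpace τ y) ≤
      ENNReal.ofReal (κ i) * ∫⁻ y : E3, (T1 i).indicator (e i) (q i (E4.ofTimeSpace τ y)) :=
    fun i ↦ setLIntegral_le_lintegral_indicator_comp (hColm i) ENNReal.ofReal_ne_top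
      fun y hy ↦ ⟨hy, hcmp' i _⟩
  constructor
  · calc ∫⁻ y in Ext, eψ (E4.ofTimeSpace τ y)
        ≤ (∫⁻ y in Far, eψ (E4.ofTimeSpace τ y)) + ∑ i, ∫⁻ y in Col i, eψ (E4.ofTimeSpace τ y) :=
          lintegral_le_lintegral_add_sum_of_subset volume Ext Far Col
            (exterior_subset_far_union_collars η τ) _
      _ ≤ (∫⁻ y in Far, eψ (E4.ofTimeSpace τ y)) +
            ∑ i, ENNReal.ofReal κs * ∫⁻ y : E3, (T1 i).indicator (e i) (q i (E4.ofTimeSpace τ y)) := by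
          gcongr with i
          exact (hC i).trans (mul_le_mul' (ENNReal.ofReal_le_ofReal (hκs i)) le_rfl)
      _ = _ := by rw [Finset.mul_sum]
  · calc ∑ i, ∫⁻ y : E3, (T1 i).indicator (e i) (q i (E4.ofTimeSpace τ y))
        ≤ ∑ i, ENNReal.ofReal (κ i) * ∫⁻ y in Ext, eψ (E4.ofTimeSpace τ y) :=
          Finset.sum_le_sum fun i _ ↦ hG i
      _ = ENNReal.ofReal (∑ i, κ i) * ∫⁻ y in Ext, eψ (E4.ofTimeSpace τ y) := by
          rw [← Finset.sum_mul, ENNReal.ofReal_sum_of_nonneg fun i _ ↦ hκ0 i]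
      _ ≤ ENNReal.ofReal κs * ∫⁻ y in Ext, eψ (E4.ofTimeSpace τ y) := by
          gcongr

/-- **The closing arithmetic of the boundedness argument** in `[0, ∞]`: from
`E(t) ≤ F + κ G(t)`, `G(t) ≤ 10 (B + 1) (G(tₐ) + K)`, `G(tₐ) ≤ κ E(tₐ)`, `E(tₐ) ≤ L E₀`,
`F ≤ f E₀` and `K = k E₀` with real constants, `E(t) ≤ (f + κ·10(B+1)(κ L + k)) E₀`. [folklore] -/
theorem late_final_bound {Et Eta E0 F Gt Gta K : ℝ≥0∞} {κs B L f k : ℝ} (hκ : 0 ≤ κs)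
    (hB : 0 ≤ B) (hL : 0 ≤ L) (hf : 0 ≤ f) (hk : 0 ≤ k)
    (h1 : Et ≤ F + ENNReal.ofReal κs * Gt)
    (h2 : Gt ≤ 10 * (ENNReal.ofReal B + 1) * (Gta + K))
    (h3 : Gta ≤ ENNReal.ofReal κs * Eta) (h4 : Eta ≤ ENNReal.ofReal L * E0)
    (h5 : F ≤ ENNReal.ofReal f * E0) (h6 : K = ENNReal.ofReal k * E0) :
    Et ≤ ENNReal.ofReal (f + κs * (10 * (B + 1)) * (κs * L + k)) * E0 := by
  have h10 : (10 : ℝ≥0∞) * (ENNReal.ofReal B + 1) = ENNReal.ofReal (10 * (B + 1)) := by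
    rw [ENNReal.ofReal_mul (by norm_num), ENNReal.ofReal_add hB zero_le_one, ENNReal.ofReal_one]
    norm_num
  calc Et ≤ F + ENNReal.ofReal κs * Gt := h1
    _ ≤ ENNReal.ofReal f * E0 +
          ENNReal.ofReal κs * (10 * (ENNReal.ofReal B + 1) * (ENNReal.ofReal κs * Eta + K)) := by
        gcongr
        exact h2.trans (by gcongr)
    _ ≤ ENNReal.ofReal f * E0 + ENNReal.ofReal κs * (10 * (ENNReal.ofReal B + 1) *
          (ENNReal.ofReal κs * (ENNReal.ofReal L * E0) + ENNReal.ofReal k * E0)) := by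
        rw [← h6]
        gcongr
    _ = (ENNReal.ofReal f + ENNReal.ofReal κs * ENNReal.ofReal (10 * (B + 1)) *
          (ENNReal.ofReal κs * ENNReal.ofReal L + ENNReal.ofReal k)) * E0 := by
        rw [h10]; ring
    _ = ENNReal.ofReal (f + κs * (10 * (B + 1)) * (κs * L + k)) * E0 := by
        congr 1
        symm
        rw [ENNReal.ofReal_add hf (by positivity),
          ENNReal.ofReal_mul (by positivity : (0 : ℝ) ≤ κs * (10 * (B + 1))),
          ENNReal.ofReal_mul hκ, ENNReal.ofReal_add (by positivity) hk, ENNReal.ofReal_mul hκ]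

end Summit.FinalStateConjecture.FinalStateConjecture.Cruxes.AdiabaticMultiKerrILED.Sketch

end
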